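import Summits.AtomisticToContinuum.Crystallization.Theses.SoftAnnulusKernel
import Summits.AtomisticToContinuum.Crystallization.Theorems.SoftAnnulusKernelSoftTwelveGap
import Literature.Geometry.DiscreteGeometry.FejesTothKissingTwelve
import Literature.Geometry.DiscreteGeometry.TameContactGraphs
import Literature.Geometry.DiscreteGeometry.KissingSearchFinal

/-!
# The floor of the ladder of crux `SoftLocalTwelveFourCommon` (route SoftAnnulusKernel, stmt-AtomisticToContinuum-18404)

Supports lemmas for the crux (forward generator G4, ladder-down from `TwoCentreKissingKernel.SoftTwoCentreFourCommon`):

* `softLocalFourCommon_of_gap_of_shell` — the birth skeleton's composition, uniformly in the tolerance range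
  `[0, ηmax]`: soft gap (stub-1 shape) + soft shell lemma (stub-2 shape) ⇒ the crux's statement up to `ηmax`
  (at `ηmax = 1/1000` this is literally `SoftLocalTwelveFourCommon`);
* `four_le_contacts_fcc` / `four_le_contacts_hcp` — every point of the FCC / HCP kissing pattern has `≥ 4`
  pattern points at distance `1` (integer models, `decide`);
* `shellFourContacts_zero` — stub 2 at `η = 0`: twelve unit vectors with pairwise distances `= 1` or `≥ 63/50`
  have `≥ 4` contacts each (the doubled set is a kissing configuration of Hales's class `𝒱`, congruent to the
  FCC or HCP pattern by `kissingConfigCongruent_of_contactGraphTame Hales2012_contactGraphTame_holds`);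
* `softLocalTwelveFourCommon_floor_of_L12` — THE FLOOR: the `η = 0` section of the crux from the named fact
  `flyspeck_L12` (via `softTwelveGap_of_flyspeckL12`) and `shellFourContacts_zero`.

The proofs through `Hales2012_contactGraphTame_holds` depend on `Lean.ofReduceBool` (the tree's verified growth
search runs by `native_decide`), exactly as `Hales2012_contactGraphFccOrHcp_holds` does.
-/

noncomputable section

namespace Summit.AtomisticToContinuum.Crystallization.Theorems

open Literature.Geometry.DiscreteGeometry

/-! ## Composition at an arbitrary tolerance range -/

/-- **Soft gap + soft shell lemma ⇒ soft local four-common**, uniformly in `ηmax`. -/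
theorem softLocalFourCommon_of_gap_of_shell {ηmax : ℝ}
    (h1 : (∀ η : ℝ, 0 ≤ η → η ≤ ηmax → ∀ Z : Set (EuclideanSpace ℝ (Fin 3)),
    (∀ x ∈ Z, ∀ y ∈ Z, x ≠ y → 1 - η ≤ dist x y) →
    ∀ u ∈ Z, {w ∈ Z | w ≠ u ∧ dist w u ≤ 1 + η}.ncard = 12 →
      ∀ v ∈ Z, v ≠ u → dist v u ≤ 1 + η ∨ (63 / 50 - 26 * η : ℝ) ≤ dist v u))
    (h2 : (∀ η : ℝ, 0 ≤ η → η ≤ ηmax → ∀ T : Finset (EuclideanSpace ℝ (Fin 3)), T.card = 12 →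
    (∀ y ∈ T, 1 - η ≤ ‖y‖ ∧ ‖y‖ ≤ 1 + η) →
    (∀ y ∈ T, ∀ y' ∈ T, y ≠ y' → 1 - η ≤ dist y y') →
    (∀ y ∈ T, ∀ y' ∈ T, y ≠ y' → dist y y' ≤ 1 + η ∨ (63 / 50 - 26 * η : ℝ) ≤ dist y y') →
    ∀ y ∈ T, 4 ≤ {y' ∈ (T : Set (EuclideanSpace ℝ (Fin 3))) | y' ≠ y ∧ dist y' y ≤ 1 + η}.ncard)) :
    ∀ η : ℝ, 0 ≤ η → η ≤ ηmax → ∀ Z : Set (EuclideanSpace ℝ (Fin 3)),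
    (∀ x ∈ Z, ∀ y ∈ Z, x ≠ y → 1 - η ≤ dist x y) →
    ∀ z ∈ Z, (∀ u ∈ Z, dist u z ≤ 1 + η → {w ∈ Z | w ≠ u ∧ dist w u ≤ 1 + η}.ncard = 12) →
    ∀ z' ∈ Z, z ≠ z' → dist z z' ≤ 1 + η →
      4 ≤ {w ∈ Z | w ≠ z ∧ w ≠ z' ∧ dist w z ≤ 1 + η ∧ dist w z' ≤ 1 + η}.ncard := by
  intro η hη0 hη1 Z hsep z hz hAll z' hz' hne hd
  set N : Set (EuclideanSpace ℝ (Fin 3)) := {w ∈ Z | w ≠ z ∧ dist w z ≤ 1 + η} with hN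
  have hNcard : N.ncard = 12 := hAll z hz (by rw [dist_self]; linarith)
  have hNfin : N.Finite := Set.finite_of_ncard_ne_zero (by rw [hNcard]; norm_num)
  obtain ⟨T, hT⟩ : ∃ T : Finset (EuclideanSpace ℝ (Fin 3)), T = hNfin.toFinset.image (fun y => y - z) := ⟨_, rfl⟩
  have hmemT : ∀ t, t ∈ T ↔ ∃ y ∈ N, y - z = t := by
    intro t
    simp only [hT, Finset.mem_image, Set.Finite.mem_toFinset]
  have hTcard : T.card = 12 := by
    rw [hT, Finset.card_image_of_injective _ sub_left_injective,
      ← Set.ncard_eq_toFinset_card N hNfin, hNcard]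
  have hnorm : ∀ t ∈ T, 1 - η ≤ ‖t‖ ∧ ‖t‖ ≤ 1 + η := by
    intro t ht
    obtain ⟨y, ⟨hyZ, hyz, hdy⟩, rfl⟩ := (hmemT t).1 ht
    rw [← dist_eq_norm]
    exact ⟨hsep y hyZ z hz hyz, hdy⟩
  have hsepT : ∀ t ∈ T, ∀ t' ∈ T, t ≠ t' → 1 - η ≤ dist t t' := by
    intro t ht t' ht' hne'
    obtain ⟨y, ⟨hyZ, -, -⟩, rfl⟩ := (hmemT t).1 ht
    obtain ⟨y', ⟨hy'Z, -, -⟩, rfl⟩ := (hmemT t').1 ht'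
    rw [dist_sub_right]
    exact hsep y hyZ y' hy'Z (fun h => hne' (by rw [h]))
  have hdich : ∀ t ∈ T, ∀ t' ∈ T, t ≠ t' →
      dist t t' ≤ 1 + η ∨ (63 / 50 - 26 * η : ℝ) ≤ dist t t' := by
    intro t ht t' ht' hne'
    obtain ⟨y, ⟨hyZ, hyz, hdy⟩, rfl⟩ := (hmemT t).1 ht
    obtain ⟨y', ⟨hy'Z, -, -⟩, rfl⟩ := (hmemT t').1 ht'
    have hyy' : y' ≠ y := fun h => hne' (by rw [h])
    have h12y : {w ∈ Z | w ≠ y ∧ dist w y ≤ 1 + η}.ncard = 12 := hAll y hyZ hdy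
    have := h1 η hη0 hη1 Z hsep y hyZ h12y y' hy'Z hyy'
    rw [dist_sub_right, dist_comm]
    exact this
  have hz'N : z' ∈ N := ⟨hz', fun h => hne h.symm, by rwa [dist_comm]⟩
  have hz'T : z' - z ∈ T := (hmemT _).2 ⟨z', hz'N, rfl⟩
  have h4 := h2 η hη0 hη1 T hTcard hnorm hsepT hdich (z' - z) hz'T
  set B : Set (EuclideanSpace ℝ (Fin 3)) := {w ∈ Z | w ≠ z ∧ w ≠ z' ∧ dist w z ≤ 1 + η ∧ dist w z' ≤ 1 + η} with hB
  have hBsubN : B ⊆ N := fun w hw => ⟨hw.1, hw.2.1, hw.2.2.2.1⟩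
  have hBfin : B.Finite := hNfin.subset hBsubN
  have hsub : {t ∈ (T : Set (EuclideanSpace ℝ (Fin 3))) | t ≠ z' - z ∧ dist t (z' - z) ≤ 1 + η} ⊆ (fun w => w - z) '' B := by
    rintro t ⟨htT, htne, htd⟩
    obtain ⟨y, ⟨hyZ, hyz, hdy⟩, rfl⟩ := (hmemT t).1 (Finset.mem_coe.1 htT)
    refine ⟨y, ⟨hyZ, hyz, fun h => htne (by rw [h]), hdy, ?_⟩, rfl⟩
    rw [dist_sub_right] at htd
    exact htd
  have hfinImg : ((fun w => w - z) '' B).Finite := hBfin.image _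
  calc 4 ≤ {t ∈ (T : Set (EuclideanSpace ℝ (Fin 3))) | t ≠ z' - z ∧ dist t (z' - z) ≤ 1 + η}.ncard := h4
    _ ≤ ((fun w => w - z) '' B).ncard := Set.ncard_le_ncard hsub hfinImg
    _ = B.ncard := Set.ncard_image_of_injective _ sub_left_injective

/-! ## The patterns are `4`-regular -/

/-- In a scaled integer pattern `{v/√N : v ∈ S}` every point has at least as many pattern points at
distance exactly `1` as its integer model has vectors at squared distance `N`. -/
theorem four_le_ncard_contacts_scaledPattern {S : Finset (Fin 3 → ℤ)} {N : ℕ} (hN : N ≠ 0)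
    (h4 : ∀ v ∈ S, 4 ≤ (S.filter fun w => w ≠ v ∧ sqNormInt (w - v) = (N : ℤ)).card)
    {p : (EuclideanSpace ℝ (Fin 3))} (hp : p ∈ scaledPattern S N) :
    4 ≤ {q ∈ (scaledPattern S N : Set (EuclideanSpace ℝ (Fin 3))) | q ≠ p ∧ dist q p = 1}.ncard := by
  classical
  obtain ⟨v, hv, rfl⟩ := Finset.mem_image.1 hp
  set g : (Fin 3 → ℤ) → (EuclideanSpace ℝ (Fin 3)) := fun w => (Real.sqrt N)⁻¹ • intVec w with hg
  have hginj : Function.Injective g := scaledPattern_map_injective hN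
  have hpos : (0 : ℝ) < Real.sqrt N := by positivity
  set W : Finset (Fin 3 → ℤ) := S.filter fun w => w ≠ v ∧ sqNormInt (w - v) = (N : ℤ) with hW
  have hsub : (g '' (W : Set (Fin 3 → ℤ))) ⊆
      {q ∈ (scaledPattern S N : Set (EuclideanSpace ℝ (Fin 3))) | q ≠ g v ∧ dist q (g v) = 1} := by
    rintro _ ⟨w, hw, rfl⟩
    have hw' := (Finset.mem_filter.1 (Finset.mem_coe.1 hw))
    refine ⟨?_, fun h => hw'.2.1 (hginj h), ?_⟩
    · exact Finset.mem_coe.2 (Finset.mem_image.2 ⟨w, hw'.1, rfl⟩)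
    · show dist ((Real.sqrt N)⁻¹ • intVec w) ((Real.sqrt N)⁻¹ • intVec v) = 1
      rw [dist_eq_norm, ← smul_sub, intVec_sub, norm_smul, norm_inv, Real.norm_of_nonneg hpos.le,
        norm_intVec, hw'.2.2, Int.cast_natCast, inv_mul_cancel₀ hpos.ne']
  have hfin : {q ∈ (scaledPattern S N : Set (EuclideanSpace ℝ (Fin 3))) | q ≠ g v ∧ dist q (g v) = 1}.Finite :=
    (Finset.finite_toSet _).subset (fun q hq => hq.1)
  calc 4 ≤ W.card := h4 v hv
    _ = (W : Set (Fin 3 → ℤ)).ncard := (Set.ncard_coe_finset W).symm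
    _ = (g '' (W : Set (Fin 3 → ℤ))).ncard := (Set.ncard_image_of_injective _ hginj).symm
    _ ≤ _ := Set.ncard_le_ncard hsub hfin

/-- Every vector of the FCC integer model has `≥ 4` model vectors at squared distance `2`. -/
theorem fccInt_four : ∀ v ∈ fccInt, 4 ≤ (fccInt.filter fun w => w ≠ v ∧ sqNormInt (w - v) = ((2 : ℕ) : ℤ)).card := by
  decide

/-- Every vector of the HCP integer model has `≥ 4` model vectors at squared distance `18`. -/
theorem hcpInt_four : ∀ v ∈ hcpInt, 4 ≤ (hcpInt.filter fun w => w ≠ v ∧ sqNormInt (w - v) = ((18 : ℕ) : ℤ)).card := by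
  decide

/-- Every point of the FCC pattern has `≥ 4` pattern points at distance `1`. -/
theorem four_le_contacts_fcc {p : (EuclideanSpace ℝ (Fin 3))} (hp : p ∈ fccKissingPattern) :
    4 ≤ {q ∈ (fccKissingPattern : Set (EuclideanSpace ℝ (Fin 3))) | q ≠ p ∧ dist q p = 1}.ncard :=
  four_le_ncard_contacts_scaledPattern (by norm_num) fccInt_four hp

/-- Every point of the HCP pattern has `≥ 4` pattern points at distance `1`. -/
theorem four_le_contacts_hcp {p : (EuclideanSpace ℝ (Fin 3))} (hp : p ∈ hcpKissingPattern) :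
    4 ≤ {q ∈ (hcpKissingPattern : Set (EuclideanSpace ℝ (Fin 3))) | q ≠ p ∧ dist q p = 1}.ncard :=
  four_le_ncard_contacts_scaledPattern (by norm_num) hcpInt_four hp

/-! ## Stub 2 at `η = 0` from Hales's classification -/

/-- Transport of the four contacts along a congruence `IsArrangedIn (2 • T) P`. -/
theorem four_le_of_isArrangedIn {T P : Finset (EuclideanSpace ℝ (Fin 3))}
    (hP : ∀ p ∈ P, 4 ≤ {q ∈ (P : Set (EuclideanSpace ℝ (Fin 3))) | q ≠ p ∧ dist q p = 1}.ncard)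
    (harr : IsArrangedIn ((fun y => (2 : ℝ) • y) '' (T : Set (EuclideanSpace ℝ (Fin 3)))) P) {y : (EuclideanSpace ℝ (Fin 3))} (hy : y ∈ T) :
    4 ≤ {y' ∈ (T : Set (EuclideanSpace ℝ (Fin 3))) | y' ≠ y ∧ dist y' y ≤ 1 + 0}.ncard := by
  obtain ⟨A, hA⟩ := harr
  have h2inj : Function.Injective (fun x : (EuclideanSpace ℝ (Fin 3)) => (2 : ℝ) • x) := smul_right_injective (EuclideanSpace ℝ (Fin 3)) two_ne_zero
  -- `y = A p` for some `p ∈ P`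
  have hy2 : (2 : ℝ) • y ∈ (fun p => (2 : ℝ) • A p) '' (P : Set (EuclideanSpace ℝ (Fin 3))) := by
    rw [← hA]; exact ⟨y, Finset.mem_coe.2 hy, rfl⟩
  obtain ⟨p, hp, hpy⟩ := hy2
  have hApy : A p = y := h2inj hpy
  -- every `A q`, `q ∈ P`, lies in `T`
  have hAT : ∀ q ∈ P, A q ∈ T := by
    intro q hq
    have : (2 : ℝ) • A q ∈ (fun y => (2 : ℝ) • y) '' (T : Set (EuclideanSpace ℝ (Fin 3))) := by
      rw [hA]; exact ⟨q, Finset.mem_coe.2 hq, rfl⟩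
    obtain ⟨y', hy', hyq⟩ := this
    have : y' = A q := h2inj hyq
    rw [← this]; exact Finset.mem_coe.1 hy'
  have hsub : (A '' {q ∈ (P : Set (EuclideanSpace ℝ (Fin 3))) | q ≠ p ∧ dist q p = 1}) ⊆
      {y' ∈ (T : Set (EuclideanSpace ℝ (Fin 3))) | y' ≠ y ∧ dist y' y ≤ 1 + 0} := by
    rintro _ ⟨q, ⟨hq, hqp, hd⟩, rfl⟩
    refine ⟨Finset.mem_coe.2 (hAT q (Finset.mem_coe.1 hq)), ?_, ?_⟩
    · intro h
      rw [← hApy] at h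
      exact hqp (A.injective h)
    · rw [← hApy, A.isometry.dist_eq, hd]; norm_num
  have hfin : {y' ∈ (T : Set (EuclideanSpace ℝ (Fin 3))) | y' ≠ y ∧ dist y' y ≤ 1 + 0}.Finite :=
    (Finset.finite_toSet T).subset (fun q hq => hq.1)
  calc 4 ≤ {q ∈ (P : Set (EuclideanSpace ℝ (Fin 3))) | q ≠ p ∧ dist q p = 1}.ncard := hP p hp
    _ = (A '' {q ∈ (P : Set (EuclideanSpace ℝ (Fin 3))) | q ≠ p ∧ dist q p = 1}).ncard :=
        (Set.ncard_image_of_injective _ A.injective).symm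
    _ ≤ _ := Set.ncard_le_ncard hsub hfin

/-- **Stub 2 at `η = 0`** (the floor's shell lemma): twelve unit vectors with pairwise distances
`= 1` or `≥ 63/50` — a kissing configuration of class `𝒱` after doubling — have `≥ 4` contacts each,
by Hales's classification (`Hales2012_contactGraphTame_holds` + Lemmas 9–10 proved in tree). -/
theorem shellFourContacts_zero :
    ∀ η : ℝ, 0 ≤ η → η ≤ 0 → ∀ T : Finset (EuclideanSpace ℝ (Fin 3)), T.card = 12 →
    (∀ y ∈ T, 1 - η ≤ ‖y‖ ∧ ‖y‖ ≤ 1 + η) →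
    (∀ y ∈ T, ∀ y' ∈ T, y ≠ y' → 1 - η ≤ dist y y') →
    (∀ y ∈ T, ∀ y' ∈ T, y ≠ y' → dist y y' ≤ 1 + η ∨ (63 / 50 - 26 * η : ℝ) ≤ dist y y') →
    ∀ y ∈ T, 4 ≤ {y' ∈ (T : Set (EuclideanSpace ℝ (Fin 3))) | y' ≠ y ∧ dist y' y ≤ 1 + η}.ncard := by
  intro η hη0 hη1 T hcard hnorm hsep hdich y hy
  have hη : η = 0 := le_antisymm hη1 hη0
  subst hη
  have hnorm1 : ∀ y ∈ T, ‖y‖ = 1 := fun y hy => by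
    have := hnorm y hy
    exact le_antisymm (by linarith [this.2]) (by linarith [this.1])
  -- the doubled configuration is a kissing configuration of class `𝒱`
  have h2inj : Function.Injective (fun x : (EuclideanSpace ℝ (Fin 3)) => (2 : ℝ) • x) := smul_right_injective (EuclideanSpace ℝ (Fin 3)) two_ne_zero
  set S : Set (EuclideanSpace ℝ (Fin 3)) := (fun y => (2 : ℝ) • y) '' (T : Set (EuclideanSpace ℝ (Fin 3))) with hS
  have hdist2 : ∀ a b : (EuclideanSpace ℝ (Fin 3)), dist ((2 : ℝ) • a) ((2 : ℝ) • b) = 2 * dist a b := by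
    intro a b; rw [dist_smul₀, Real.norm_of_nonneg zero_le_two]
  have hK : IsKissingConfig S := by
    refine ⟨?_, ?_, ?_⟩
    · rw [hS, Set.ncard_image_of_injective _ h2inj, Set.ncard_coe_finset, hcard]
    · rintro _ ⟨a, ha, rfl⟩
      rw [norm_smul, Real.norm_of_nonneg zero_le_two, hnorm1 a (Finset.mem_coe.1 ha)]; norm_num
    · rintro _ ⟨a, ha, rfl⟩ _ ⟨b, hb, rfl⟩
      by_cases hab : a = b
      · exact Or.inl (by rw [hab])
      · have ha' := Finset.mem_coe.1 ha
        have hb' := Finset.mem_coe.1 hb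
        right
        rw [hdist2, hales_h0_eq]
        rcases hdich a ha' b hb' hab with h | h
        · left
          have h1 : 1 - 0 ≤ dist a b := hsep a ha' b hb' hab
          have : dist a b = 1 := by linarith
          rw [this]; norm_num
        · right
          have : (63 / 50 : ℝ) ≤ dist a b := by linarith
          nlinarith
  have hcong : IsArrangedIn S fccKissingPattern ∨ IsArrangedIn S hcpKissingPattern :=
    kissingConfigCongruent_of_contactGraphTame Hales2012_contactGraphTame_holds S hK
  rcases hcong with h | h
  · exact four_le_of_isArrangedIn (fun p hp => four_le_contacts_fcc hp) h hy
  · exact four_le_of_isArrangedIn (fun p hp => four_le_contacts_hcp hp) h hy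


/-! ## THE FLOOR of the ladder: the `η = 0` section of the crux, modulo the named fact `flyspeck_L12` -/

/-- **The floor of the ladder of crux `SoftLocalTwelveFourCommon`** (Hales 2012, Theorem 1, read
locally): in a `1`-separated `Z ⊂ ℝ³`, if `z` and every point of `Z` within distance `1` of `z` are
twelve-kissed, every touching neighbour `z'` of `z` has `≥ 4` common neighbours with `z` — the crux's
statement with the tolerance range `[0, 10⁻³]` replaced by `{0}`.  From the soft `L12` lemma
(`softTwelveGap_of_flyspeckL12`, hence the HOL-Light-verified named fact `flyspeck_L12`) and the `η = 0`
shell lemma (`shellFourContacts_zero`, from the tree's proved classification). [cite: Hales2012, Theorem 1 (proof, pp. 2 and 14)] -/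
theorem softLocalTwelveFourCommon_floor_of_L12 (hL12 : flyspeck_L12) :
    ∀ η : ℝ, 0 ≤ η → η ≤ 0 → ∀ Z : Set (EuclideanSpace ℝ (Fin 3)),
    (∀ x ∈ Z, ∀ y ∈ Z, x ≠ y → 1 - η ≤ dist x y) →
    ∀ z ∈ Z, (∀ u ∈ Z, dist u z ≤ 1 + η → {w ∈ Z | w ≠ u ∧ dist w u ≤ 1 + η}.ncard = 12) →
    ∀ z' ∈ Z, z ≠ z' → dist z z' ≤ 1 + η →
      4 ≤ {w ∈ Z | w ≠ z ∧ w ≠ z' ∧ dist w z ≤ 1 + η ∧ dist w z' ≤ 1 + η}.ncard :=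
  softLocalFourCommon_of_gap_of_shell
    (fun η hη0 hη1 => softTwelveGap_of_flyspeckL12 hL12 η hη0 (hη1.trans (by norm_num)))
    shellFourContacts_zero

end Summit.AtomisticToContinuum.Crystallization.Theorems

end
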